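import Summits.BirchSwinnertonDyer.BirchSwinnertonDyer.Theorems.ManinLocalTwoThreeStevensCurveOfCuspZero
import Summits.BirchSwinnertonDyer.BirchSwinnertonDyer.Theorems.ManinLocalTwoThreeShimuraThreeTorsionCoprimeTotient
import HarnessLib

/-!
# The `p = 3` twin of the cusp-zero dichotomy: a Shimura `3`-kernel at `9 ∣ N` (E-an-221's hypothesis `KummerShimura`) needs `3 ∣ ord φ₀(0)` — the
# cuspidal point of `E₀` has order divisible by `3`, the cusp `0` does NOT map to the origin (`L(f,1) ≠ 0`), root number `+1` recovered (mod F★, F♮, CES)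
(route `ManinLocalTwoThree`, crux C3 `ManinPrimeToThreeAtNine` stmt-BirchSwinnertonDyer-22968 and C2 stmt-…-22967; cell bsd-f2-manin, C2/C3 LEAD p1 gen 18;
`--supports stmt-BirchSwinnertonDyer-22968`; sequel to `…StevensCurveOfCuspZero` (Θ at `m = 1` and the coprime-annihilator collapse))

* `three_dvd_of_natMul_modularSymbol_zero_mem_of_ne_of_nine_dvd_of_print` — at `9 ∣ N` (`3Λ₀ ⊆ Λ₁`, traceless `3`): `Λ₁(f) ≠ Λ₀(f)` ⟹ every `m` with
  `m·{∞,0}_f ∈ Λ₀(f)` is divisible by `3`;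
* `modularSymbol_zero_not_mem_of_kummerShimura_of_print`, `three_dvd_of_natMul_modularSymbol_zero_mem_of_kummerShimura_of_print` — E-an-221's hypothesis
  (a Kummer–Shimura third-period `u`, `3u ∈ Λ_E`, lattice-optimal datum at `9 ∣ N`) forces `{∞,0}_f ∉ Λ₀(f)` (analytic rank `0`) and `3 ∣ m` for every
  annihilating `m` (so `E₀(ℚ)` has a point of order divisible by `3` — the Manin–Drinfeld point `φ₀(0)` itself; consistent with E-an-221's conclusion
  «rational `3`-torsion», here from Θ instead of the cusp-lifting law);
* `six_dvd_…` — at `36 ∣ N` nothing is left (`Λ₁ = Λ₀` by the tree's `periodLatticeGamma1_eq_of_four_dvd_of_odd_sq_dvd`), recorded as the vacuous corner.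
HONEST FRAMING: conditional on the three statement-only printed cusp facts F★, F♮, CES; E-an-221 / C3 / C2 / Manin / BSD are NOT proved.  No definitions, no sorry.
[cite: Stevens1982, Thm. 1.3.1] [cite: ConradEdixhovenStein2003, §6.1.2] [cite: LingOesterle1991, Thm. 6] [cite: Manin1972, Thm. 3.5 / Cor. 3.6]
-/

set_option autoImplicit false
-- lint-debt: the directory name repeats the summit name (sibling precedent `ManinLocalTwoThreeStevensCurveOfCuspZero.lean`)
set_option linter.dupNamespace false

noncomputable section

open scoped MatrixGroups ModularForm
open CongruenceSubgroup Complex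
open WeierstrassCurve Literature.NumberTheory.EllipticCurves Literature.NumberTheory.EllipticCurves.ModularForms
open Summit.BirchSwinnertonDyer.Rank1Residual.ManinAdditive.UDCKummerLineK

namespace Summit.BirchSwinnertonDyer.BirchSwinnertonDyer.Theorems.ManinLocalTwoThree.SigmaHabitat

variable {W : WeierstrassCurve ℚ} [W.IsElliptic] [W.IsGloballyMinimal] {N : ℕ} [NeZero N]

/-- **At `9 ∣ N`: `Λ₁(f) ≠ Λ₀(f)` ⟹ `3 ∣ m` for every `m` with `m·{∞,0}_f ∈ Λ₀(f)`** (Θ + `3Λ₀ ⊆ Λ₁` + Bézout; mod F★, F♮, CES).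
[cite: Stevens1982, Thm. 1.3.1] [cite: LingOesterle1991, Thm. 6] -/
theorem three_dvd_of_natMul_modularSymbol_zero_mem_of_ne_of_nine_dvd_of_print (hF : optimalGamma1Parametrization_cusp_rational)
    (hFnat : optimalGamma1Parametrization_cuspZero_galoisConjugate) (hCES : exists_optimal_gamma1ParametrizationData)
    (D : ModularParametrizationData W N) (hopt : ∀ z ∈ D.L.lattice, ∃ w ∈ periodLattice D.f, z = D.c * w) (h9 : 3 ^ 2 ∣ N)
    (hne : periodLatticeGamma1 D.f ≠ periodLattice D.f) {m : ℕ} (hm : (m : ℂ) * modularSymbol D.f 0 ∈ periodLattice D.f) : 3 ∣ m := by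
  by_contra h3
  exact hne (periodLatticeGamma1_eq_of_natMul_mem_of_coprime_cuspZero_of_print hF hFnat hCES D hopt
    (fun z hz ↦ by exact_mod_cast three_mul_mem_periodLatticeGamma1_of_nine_dvd D h9 hz) hm
    ((Nat.Prime.coprime_iff_not_dvd Nat.prime_three).mpr h3))

/-- **E-an-221's hypothesis forces `{∞,0}_f ∉ Λ₀(f)`** (the cusp `0` does not map to the origin of `E₀`; `L(f,1) ≠ 0`): a Kummer–Shimura third-period
(`KummerShimura D u`, `3u ∈ Λ_E`, lattice-optimal datum) is incompatible with `Λ₁ = Λ₀` (tree `not_kummerShimura_of_periodLatticeGamma1_eq`), which Θ at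
`m = 1` would give (mod F★, F♮, CES). [cite: Stevens1982, Thm. 1.3.1] [cite: Stevens1989, §2] -/
theorem modularSymbol_zero_not_mem_of_kummerShimura_of_print (hF : optimalGamma1Parametrization_cusp_rational)
    (hFnat : optimalGamma1Parametrization_cuspZero_galoisConjugate) (hCES : exists_optimal_gamma1ParametrizationData)
    (D : ModularParametrizationData W N) (hopt : ∀ z ∈ D.L.lattice, ∃ w ∈ periodLattice D.f, z = D.c * w)
    {u : ℂ} (hu₂ : 3 * u ∈ D.L.lattice) (hS : KummerShimura D u) : modularSymbol D.f 0 ∉ periodLattice D.f :=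
  fun h0 ↦ not_kummerShimura_of_periodLatticeGamma1_eq D hopt
    (periodLatticeGamma1_eq_of_modularSymbol_zero_mem_of_print hF hFnat hCES D hopt h0) hu₂ hS

/-- **E-an-221's hypothesis forces `3 ∣ ord φ₀(0)`** at `9 ∣ N`: every `m` with `m·{∞,0}_f ∈ Λ₀(f)` is divisible by `3` (so the rational cuspidal point
`φ₀(0) ∈ E₀(ℚ)` has order divisible by `3`; mod F★, F♮, CES). [cite: Stevens1982, Thm. 1.3.1] [cite: LingOesterle1991, Thm. 6] -/
theorem three_dvd_of_natMul_modularSymbol_zero_mem_of_kummerShimura_of_print (hF : optimalGamma1Parametrization_cusp_rational)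
    (hFnat : optimalGamma1Parametrization_cuspZero_galoisConjugate) (hCES : exists_optimal_gamma1ParametrizationData)
    (D : ModularParametrizationData W N) (hopt : ∀ z ∈ D.L.lattice, ∃ w ∈ periodLattice D.f, z = D.c * w) (h9 : 3 ^ 2 ∣ N)
    {u : ℂ} (hu₂ : 3 * u ∈ D.L.lattice) (hS : KummerShimura D u) {m : ℕ} (hm : (m : ℂ) * modularSymbol D.f 0 ∈ periodLattice D.f) :
    3 ∣ m :=
  three_dvd_of_natMul_modularSymbol_zero_mem_of_ne_of_nine_dvd_of_print hF hFnat hCES D hopt h9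
    (fun heq ↦ not_kummerShimura_of_periodLatticeGamma1_eq D hopt heq hu₂ hS) hm

omit [W.IsElliptic] [W.IsGloballyMinimal] in
/-- **The annihilating `m` exists** (Manin–Drinfeld for the rational newform of `D`): some `m ≥ 1` has `m·{∞,0}_f ∈ Λ₀(f)` — so the divisibility
statements above are not vacuous. [cite: Manin1972, Thm. 3.5 / Cor. 3.6] -/
theorem exists_pos_natMul_modularSymbol_zero_mem (D : ModularParametrizationData W N) :
    ∃ m : ℕ, 0 < m ∧ (m : ℂ) * modularSymbol D.f 0 ∈ periodLattice D.f := by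
  obtain ⟨m, hm, h⟩ := exists_nsmul_modularSymbol_mem_periodLattice_of_isNewform0 D.isNewformOf.1
    D.isNewformOf.coeffField_eq_bot 0
  exact ⟨m, hm, by simpa [nsmul_eq_mul] using h⟩

end Summit.BirchSwinnertonDyer.BirchSwinnertonDyer.Theorems.ManinLocalTwoThree.SigmaHabitat

end
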